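import Literature.NumberTheory.EllipticCurves.AnticyclotomicRankinSelbergPAdicLFunction
import HarnessLib

/-!
# Hsieh 2014, Theorem A (= Thm. 1 / Thm. 5.6 of the e-print; Thm. 5.7 of Doc. Math. 19) AT EVERY LEVEL:
# the anticyclotomic Rankin–Selberg `p`-adic `L`-function `𝒫_Σ(π_f, λ)² ∈ Z̄_p⟦Γ⁻⟧` for a weight-2 newform `f`
# of level `N` with `p^a ∣ N` ARBITRARY (`a = v_p(N) ≥ 2`, i.e. `π_{f,p}` supercuspidal or a ramified twist,
# INCLUDED) — ONE named fact extending the tree's `hsieh2014_exists_anticyclotomicPAdicLFunction_unrPeriod`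
# (which carries the binder `¬ p ^ 2 ∣ N`) by ONE reading of the Coates multiplier at an additive prime

Topic `NumberTheory/EllipticCurves`, sub-directory `Hsieh2014` (namespace = path; companion of
`Hsieh2014/AnticyclotomicMuInvariant.lean` (Thm. B) and of the Thm. A file
`AnticyclotomicRankinSelbergPAdicLFunction.lean`, whose frame `IsHsiehLFunction`, display
`hsiehInterpolationValue`, receptacle `PowerSeries (PadicComplexInt p) = 𝒪_{ℂ_p}⟦T⟧`, binders and module docstring
((S1)–(S8), (W1)–(W4), (E1)–(E2), ERRATUM E-G131-1) are used VERBATIM and not restated). Cell `bsd-cn100`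
(HOME `run/shared/lean/pub/bsd-cn100/`), typer seat `bsd-cn100-ty` (g9), target (T1) of the cell plan
(D0074-bsd-cn100-seats §6 addendum 7; plan ruling 2026-08-26T23:15:12Z (2)): the PRINT input of the (LB-exist) line
of route `MordellShaFreeCut` (rung S2b), crux `RankPosOfThreeSelmerCorankOne` (stmt-BirchSwinnertonDyer-19159,
registered stub `stub_threeAdicBDPElementExists`) at the ADDITIVE prime `3` of the `j = 0` curves `x³ + y³ = D`
(`v₃(N) ≥ 2` for every such curve), where the tree's Thm. A fact is silent because of its binder `¬ p ^ 2 ∣ N`.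
HONEST FRAMING: ONE named fact (`def … : Prop`, nothing asserted, no `_holds`; net debt +1) that IMPLIES the two
existing Thm. A facts (proved in the sibling proof file `AnticyclotomicPAdicLFunctionAnyLevelCorollaries.lean` by
re-inserting the dropped binder) — this file holds the STATEMENT ONLY; nothing about crux A/B of S2b, the
leaf, Sylvester's problem or any case of BSD is proved or claimed. In particular NOTHING is asserted about the
`R₀ = 𝒪(𝐐̂_p^ur)`-rationality of the element (Hsieh's receptacle is `Z̄_p⟦Γ⁻⟧ ⊆ 𝒪_{ℂ_p}⟦T⟧`; see "NOT typed").

## Source and what is new here (e-print locators `[p. … l. …]` = arXiv:1112.1580 as in the companion; print =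
## Doc. Math. 19 (2014) 709–767, Thm. A p. 712 = Thm. 5.7 p. 754, ERRATUM E-G131-1 of the companion)

The printed theorem (quoted in full in the companion's module docstring) constructs `𝒫_Σ(π, λ) ∈ Λ = Z̄_p⟦Γ⁻⟧` with
`φ̂(𝒫_Σ(π,λ)²)/Ω_p^{2(κ+2m)} = [𝒪_𝓚^×:𝒪_𝓕^×]² · Γ_Σ(κ+m)Γ_Σ(m+1)/((Im δ)^{κ+2m}(4π)^{κ+2m+1·Σ}) · E_{Σ_p}(π, λφ) ·
L(½, π_𝓚 ⊗ λφ)/Ω_𝓚^{2(κ+2m)} · φ(ℭ) C(π, λ)` for every `φ̂ ∈ 𝔛` of weight `(m, −m)` [p. 4 ll. 13–18], under: `p` odd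
[p. 3 l. 24], (ord) [p. 3 ll. 26–28], Hypothesis 1 [p. 3 l. 22] and (sf) [p. 4 l. 13] (conditions at the primes of
`𝔫⁻` only), `λ` unitary of infinity type `(κ/2, −κ/2)` with `λ|_{𝔸_𝓕^×} = ω⁻¹` [p. 3 ll. 4–5, l. 20]. The LEVEL
DATUM is "`𝔑` the prime-to-`p` conductor of `π_𝓚 ⊗ λ`" [p. 4 l. 1] and there is NO hypothesis on the local
component `π_p`: the `p`-modified Whittaker function `W^♭_{χ,v} = W_{𝟙_{𝒪^×}χ_w(a⁻¹)}` (§3.6.2, [p. 11 ll. 61–64]) is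
defined in the Kirillov model of EVERY `π_v` (it is a Schwartz function on `F^×`), and the split-prime computation
Prop. 3.5 [p. 12 ll. 101–108] ("If `v = ww̄` with `w ∈ Σ̄_p`, then `L(½, π_E ⊗ χ)⁻¹ · P(π(ς)W^♭_{χ,v}, χ) =
ε(½, π ⊗ χ_w, ψ)/L(½, π ⊗ χ_w)² · ω⁻¹χ_w⁻²(−2δ)|𝒟_F|`") is unconditional in `π_v`; accordingly the Coates multiplier
`E_{Σ_p}(π, χ) = ∏_{w ∈ Σ_p, v = ww̄} ε(½, π_v ⊗ χ_w̄, ψ_v) · L(½, π_v ⊗ χ_w̄)^{−2} · ω⁻¹χ_w^{−2}(−2δ)` [p. 4 ll. 9–11;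
Thm. 3.18 p. 17 ll. 15–17] is a SYMBOL valid for every `π_p`. The companion typed the theorem with the binder
`¬ p ^ 2 ∣ N` ((S5)) for ONE reason, stated there: its evaluation (E1) of `E_{Σ_p}(π_f, χ)` was carried out only for
`π_p` an unramified principal series (`p ∤ N`) or Steinberg (`p ‖ N`). This file supplies the remaining evaluation:

* **(E1″) the multiplier at a prime with `v_p(N) = a ≥ 2`, for `χ` of the typed range (unramified at every finite
  place, in particular at `𝔭`; `ψ_p` of conductor `ℤ_p`; `ω = 1`).** (i) `L(½, π_p ⊗ χ_𝔭) = 1`: `π_p = π_{f,p}` has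
  trivial central character and conductor exponent `a ≥ 2` (the conductor of `π_f` is `N`), so it is supercuspidal, or
  `π(μ, μ⁻¹)` with `μ` ramified, or `μ·St` with `μ` ramified quadratic; twisting by the UNRAMIFIED `χ_𝔭` keeps every
  constituent character ramified, and the local `L`-factor is `1` in all three cases (Bump 1997, §4.7 (7.9)–(7.10)
  [held text p. 516 ll. 3–12]: "If `π` is supercuspidal, we define `L(s, π) = 1`"; for `π(χ₁, χ₂)` resp. `σ(χ₁, χ₂)`
  the factors carry "`α_i = χ_i(ϖ)` if `χ_i` is nonramified and `α_i = 0` otherwise"; `ξ ⊗ π(χ₁,χ₂) = π(ξχ₁, ξχ₂)`) —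
  Hsieh's own first case of §3.6.2 [p. 11 l. 25] ("If the local `L`-function `L(s, π ⊗ χ_w) = 1`, we simply put
  `𝒦_{χ,v}(a) = 𝟙_{𝒪^×}(a)χ_w(a⁻¹)`"). Consistently, the companion's typed Euler polynomial `(1 − a_p p⁻¹x + e_p x²)²`
  (`e_p = 0` for `p ∣ N`) EQUALS `1 = L(½, π_p ⊗ χ_𝔭)^{−2}` here because `a_p(f) = 0` for a newform of level `N`
  with trivial character and `p² ∣ N` (Atkin–Lehner 1970, Thm. 3); so the display `hsiehInterpolationValue` is reused
  UNCHANGED. (ii) `ε(½, π_p ⊗ χ_𝔭, ψ_p) = ε(½, π_p, ψ_p) · χ_𝔭(p)^{a}`: the twist of a local `ε`-factor by an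
  UNRAMIFIED character `ν` is `ε(½, Π ⊗ ν, ψ) = ε(½, Π, ψ)·ν(ϖ)^{a(Π) + 2v(𝒟)}` — the "well-known fact" Hsieh invokes
  verbatim in the proof of Lemma 5.4 (2) [p. 23 ll. 36–38]: "`ε(½, π_v ⊗ λ_wφ_w, ψ_v) = ε(½, π_v ⊗ λ_w, ψ)
  φ_w(𝒟_𝓕² ℭ)` (`v = ww̄`, `w ∣ ℭ`)", read at `v = p`, `Π = π_p`, `ν = χ_𝔭`, `𝒟_ℚ = 1`, `a(π_p) = v_p(N) = a`.
  Here `ε(½, π_p, ψ_p) = W_p(f) ∈ {±1}` is the local root number (`ω_p = 1`; Kellock–Dokchitser 2023, Rem. 2.2: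
  "`ε(½, π_p) = λ_p`", the Atkin–Lehner sign of the local newform, R. Schmidt 2002 Thm. 3.2.2; a sign: Rohrlich 1993,
  Prop. 2) — a `φ`-INDEPENDENT unit, put into the constant `C` exactly as the companion puts the Steinberg sign `−a_p`
  there ((W3); the printed property `‖ι⁻¹C‖_p = 1` is kept); and `χ_𝔭(p)^{a} = (p^{n}·ι(r_χ(g_𝔭)))^{a}` by Hsieh's
  dictionary [p. 3 ll. 28–30] exactly as in (W3) (`g_𝔭 ∈ Γ⁻` a FIXED element), so the avatar value is removed by the
  group-ring unit `[g_𝔭]^{−a}` (the typed element is `Q := [g]⁻¹ · Tw_{λ̂⁻¹}(𝒫_Σ(π_f,λ)²)` with `g := σ_ℭ · g_𝔭^{a}`,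
  (W2)–(W3) verbatim), and the REAL monomial `p^{na}` survives. (iii) `ω⁻¹χ_w^{−2}(−2δ) = 1` as in (E2) (unchanged:
  `χ` unramified at both primes above `p`, `−2δ` a unit there).
* **Absorption into the ∃-quantified archimedean constant `A`.** On the typed range Hsieh's value at a prime with
  `v_p(N) = a ≥ 1` therefore carries `p^{na}/(Im δ)^{2n}`, while the companion's display carries
  `ρ_p/A^{2n} = p^{n}/A^{2n}` (`p ∣ N`); the two agree for `A := Im σ̄₀(δ) · p^{(1 − a)/2} > 0` (for `a = 1` this is
  the companion's `A = Im σ̄₀(δ)`; for `a = 0` nothing changes). The companion's `A` is ALREADY only "`∃ A : ℝ,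
  0 < A`" ((W4): "only `A^{2n}` enters"; and (E1): "since `A` is existentially quantified, even the sign of the
  exponent of `p^{±n}` is immaterial to the TRUTH of the typed statement") — so the typed conclusion below is the SAME
  frame `(A, Ω_K, C, Ω_p, Q)` with `IsHsiehLFunction ι 𝔭 κ γ f A Ω_K C Ω_p Q` and the SAME side conditions, now
  WITHOUT the binder `¬ p ^ 2 ∣ N`. A reader must NOT identify the typed `A` with `Im δ` at an additive prime (nor
  the typed `Ω_K`, `Ω_p`, `Q` with Hida–Tilouine's periods / Hsieh's `𝒫`, as the companion already warns).
* Everything else — (S1)–(S4), (S6)–(S8) (in particular: `𝔑` = the PRIME-TO-`p` conductor, so `p^a ∣ N` never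
  enters `𝔑`, `ℭ`, Hypothesis 1 or (sf); every `ℓ ∣ N` splits in `K`, so `𝔫⁻ = 1` and Hypothesis 1 / (sf) are
  vacuous; `λ` ramified at `p` allowed and necessarily so, (S7)), (W1)–(W4), (E2) — is the companion's, unchanged.

The period is typed in its printed home `Ω_p ∈ 𝒲^× = R₀^×` as in the companion's `_unrPeriod` variant (Hsieh
[p. 23 l. 64]: "`(Ω_∞, Ω_p) ∈ (ℂ^×)^Σ × (Z̄_p^×)^Σ` the complex and CM periods of `(𝒦, Σ)` introduced in [HT93]
(`(Ω, c)` in [Katz78])"; Castella–Hsieh 2018 §2.5: `(Ω_K, Ω_p) ∈ ℂ^× × 𝒲^×`); the norm-one form follows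
(`hsieh2014_exists_anticyclotomicPAdicLFunction_of_anyLevel`, sibling proof file).

NOT typed, NOT asserted (as in the companion, verbatim): `Q ∈ R₀⟦T⟧` (Hsieh's proof works over `𝒲 = W(𝔽̄_p)[λ]`
with `λ` ramified at `p` in general, and `C` contains `C(π,λ)` and `ι(r_λ(σ_ℭ))⁻¹`); the statement
`∃ L : UnrSeries p, IsBDPLFunction …` of the tree frame (Castella 2018 Thm. 3.1, `p ≥ 5`) does NOT follow from this
fact by re-parametrisation and unit bookkeeping alone — the `R₀`-DESCENT of `Q` is a separate statement (at
`3 ‖ N` it is the crux `HsiehDescentAtThree` of the routes `ClassRecordThree` / `KolyvaginRoadThree`; at `3² ∣ N`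
it is the corresponding residual of S2b's (LB-exist), cell STATUS 2026-08-27T00:29:47Z).
-- TODO(general form): Hsieh's Thm. 1 for a totally real `𝓕`, CM type `Σ`, parallel weight `κ` and the full
-- range `φ̂ ∈ 𝔛` (characters ramified at `p`), which needs local `ε`-factors of `GL₂` as tree objects.

## References

* [Hsieh2014] M.-L. Hsieh, *Special values of anticyclotomic Rankin–Selberg L-functions*, Doc. Math. 19 (2014)
  709–767 = arXiv:1112.1580: Thm. 1 [pp. 3–4] = Thm. A (p. 712), Thm. 5.6 [p. 23] = Thm. 5.7 (p. 754); §3.6.2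
  [p. 11 l. 25, ll. 61–64]; Prop. 3.5 [p. 12]; Thm. 3.18 [p. 17]; proof of Lemma 5.4 (2) [p. 23 ll. 36–38];
  the periods [p. 23 l. 64]; the dictionary [p. 3 ll. 28–30] — read 2026-08-27 from the store text
  `paper:arxiv-1112.1580`.
* [Bump1997] D. Bump, *Automorphic forms and representations*, CUP 1997, §4.7 (7.9)–(7.10) (held text p. 516).
* [AtkinLehner1970] A. O. L. Atkin, J. Lehner, *Hecke operators on `Γ₀(m)`*, Math. Ann. 185 (1970), Thm. 3
  (`a(p) = 0` for a newform when `p² ∣ m`).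
* [KellockDokchitser2023] L. C. Kellock, V. Dokchitser, *Root numbers and parity phenomena*, Rem. 2.2
  (`ε(½, π_p) = λ_p`, Schmidt 2002 Thm. 3.2.2); [Rohrlich1993Compositio] D. Rohrlich, Compositio Math. 87 (1993),
  Prop. 2 (the local root number is a sign).
* [CastellaHsieh2018] F. Castella, M.-L. Hsieh, Math. Ann. 370 (2018), §2.5 (arXiv:1505.08165 p. 7: the periods
  `(Ω_K, Ω_p) ∈ ℂ^× × 𝒲^×`); [Castella2018] F. Castella, Camb. J. Math. 6 (2018), Thm. 3.1 (the tree frame).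
* Tree: `AnticyclotomicRankinSelbergPAdicLFunction.lean` (everything reused); sibling proof file
  `Hsieh2014/AnticyclotomicPAdicLFunctionAnyLevelCorollaries.lean` (the corollaries).
-/

noncomputable section

open scoped MatrixGroups ModularForm Topology NumberField
open CongruenceSubgroup NumberField IsDedekindDomain Field
open Literature.NumberTheory.GaloisRepresentations
open Literature.NumberTheory.EllipticCurves.ModularForms
open Literature.NumberTheory.Automorphic

namespace Literature.NumberTheory.EllipticCurves.Hsieh2014

/-- **Hsieh, Doc. Math. 19 (2014), Theorem A (p. 712) = Thm. 1 [arXiv:1112.1580 pp. 3–4] = Thm. 5.6 [p. 23], WITH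
THE `p`-ADIC CM PERIOD IN `𝒲^×` AND WITHOUT ANY CONDITION ON `v_p(N)`** — the named fact
`hsieh2014_exists_anticyclotomicPAdicLFunction_unrPeriod` of the companion VERBATIM (same binders in the same
order, same conclusion `∃ A Ω_K C Ω_p Q, 0 < A ∧ Ω_K ≠ 0 ∧ ‖ι⁻¹C‖ = 1 ∧ IsHsiehLFunction ι 𝔭 κ γ f A Ω_K C Ω_p Q`
with `Ω_p : (unrIntegers p)ˣ`, `Q : PowerSeries (PadicComplexInt p)`), EXCEPT that the binder `¬ p ^ 2 ∣ N`
((S5) of the companion) is DROPPED: `π_{f,p}` may have conductor `p^a`, `a ≥ 2` (supercuspidal or a ramified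
twist). Justification = the companion's (S1)–(S4), (S6)–(S8), (W1)–(W4), (E2) verbatim (Hsieh's level datum is the
PRIME-TO-`p` conductor of `π_𝓚 ⊗ λ` [p. 4 l. 1]; (ord) is a condition on the CM type only [p. 3 ll. 26–28]; the
`p`-modified Whittaker function of §3.6.2 and Prop. 3.5 [p. 12] are defined/valid for every `π_p`) plus the ONE
new reading (E1″) of the module docstring: at `v_p(N) = a ≥ 2` and `χ` unramified, `E_{Σ_p}(π_f, χ) =
ε(½, π_p, ψ_p) · χ_𝔭(p)^{a} · 1` (`L(½, π_p ⊗ χ_𝔭) = 1`, Bump §4.7 (7.9)–(7.10) with Hsieh §3.6.2 first case; the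
typed Euler polynomial is `1` too since `a_p(f) = 0`, Atkin–Lehner Thm. 3; the unramified-twist rule for `ε` =
Hsieh's "well-known fact" [p. 23 ll. 36–38]; `ε(½, π_p, ψ_p) = ±1` into `C`, the avatar value `ι(r_χ(g_𝔭))^{a}`
removed by `[g_𝔭]^{−a}` as in (W3), the real monomial `p^{na}/(Im δ)^{2n}` absorbed by the ∃-quantified `A`:
`A = Im σ̄₀(δ)·p^{(1−a)/2}`). WEAKER than print on its range (special case `𝓕 = ℚ`, `κ = 2`, unramified critical
characters), never stronger; it IMPLIES the companion's two Thm. A facts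
(theorems `hsieh2014_exists_anticyclotomicPAdicLFunction_unrPeriod_of_anyLevel` and `…_of_anyLevel` of the
sibling proof file `AnticyclotomicPAdicLFunctionAnyLevelCorollaries.lean`). NOT asserted:
`Q ∈ R₀⟦T⟧` (module docstring). Named fact; nothing asserted; no `_holds`.
[cite: Hsieh2014, Thm. A p. 712 (Doc. Math. 19) = Thm. 1 (arXiv:1112.1580 pp. 3–4, p. 4 l. 1), Prop. 3.5 (p. 12), §3.6.2 (p. 11 l. 25), proof of Lemma 5.4 (2) (p. 23 ll. 36–38), p. 23 l. 64]
[cite: Bump1997, §4.7 (7.9)–(7.10) (p. 516)] [cite: AtkinLehner1970, Thm. 3]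
[cite: KellockDokchitser2023, Rem. 2.2] [cite: CastellaHsieh2018, §2.5 (arXiv:1505.08165 p. 7)] -/
def thmA_exists_isHsiehLFunction_unrPeriod_anyLevel : Prop :=
  ∀ {p : ℕ} [Fact p.Prime] (ι : PadicAlgCl p ≃+* ℂ) (K : Type) [Field K] [NumberField K]
    (𝔭 : HeightOneSpectrum (𝓞 K)) (κ : ZpExtension K p) (γ : absoluteGaloisGroup K)
    {N : ℕ} [NeZero N] (f : CuspForm (Gamma0 N) 2) (lam : HeckeCharacter K)
    (rlam : FramedGaloisRep K (PadicAlgCl p) 1),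
    p ≠ 2 → IsNewform0 f →
    IsImaginaryQuadratic K → ((Ideal.span {(p : ℤ)}).primesOver (𝓞 K)).ncard = 2 →
    ((p : ℕ) : 𝓞 K) ∈ 𝔭.asIdeal →
    (∀ (w : InfinitePlace K) (k : 𝓞 K), k ∈ 𝔭.asIdeal ↔ ‖ι.symm (w.embedding (k : K))‖ < 1) →
    SatisfiesHeegnerHypothesis N K →
    lam.IsUnitary → lam.HasInfinityType (fun _ ↦ (1 : ℤ)) (fun _ ↦ (-1 : ℤ)) →
    (∀ x : ideleGroup ℚ, lam (AdeleRing.ideleBaseChange ℚ K x) = 1) →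
    (∀ v : HeightOneSpectrum (𝓞 K), ((p : ℕ) : 𝓞 K) ∉ v.asIdeal → lam.IsUnramifiedAt v) →
    IsPAdicAvatarOf ι lam rlam → FactorsThroughZp κ rlam →
    κ.IsAnticyclotomic → κ.IsTopGenerator γ →
    ∃ (A : ℝ) (ΩK C : ℂ) (Ωp : (unrIntegers p)ˣ) (Q : PowerSeries (PadicComplexInt p)),
      0 < A ∧ ΩK ≠ 0 ∧ ‖((ι.symm C : PadicAlgCl p) : ℂ_[p])‖ = 1 ∧
        IsHsiehLFunction ι 𝔭 κ γ f A ΩK C ((Ωp : unrIntegers p) : ℂ_[p]) Q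

end Literature.NumberTheory.EllipticCurves.Hsieh2014

end
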